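import Mathlib
import Summits.NavierStokesRegularity.NavierStokesRegularity.Statement
import Summits.NavierStokesRegularity.NavierStokesRegularity.Theses.EulerZoomLiouville
import Summits.NavierStokesRegularity.NavierStokesRegularity.Theorems.EulerZoomLiouvilleSereginZoomReduction
import Literature.Analysis.FluidPDE.ClassicalSuitable
import Literature.Analysis.FluidPDE.SuitableWeakRescaling
import Literature.Analysis.FluidPDE.NSViscosityRescaling
import Literature.Analysis.FluidPDE.ForwardDSSMollifiedSchemeEnergy
import Literature.Analysis.FluidPDE.WholeSpaceIBP
import HarnessLib

/-!
# ConservativeEngine (cut) — THE EXACT ENGINE CUT `X_E ⟺ X_Eᶜ ∧ X_Eᵈ` (def-free certificate)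

NODE N30 «THE CONSERVATIVE ENGINE» (decomp-ns lens-6 g18; critic row 196, CLEARED 2026-08-30T16:11:31Z).  The route crux
X_E = `EulerZoomLiouville.PowerGaugeEulerLiouville` (stmt-19832, verbatim decl) is EQUIVALENT to the conjunction of its CONSERVATIVE
half X_Eᶜ (members of the power-gauged ancient Euler class `K_ρ` with ZERO Duchon–Robert defect — the text below is the child
route's crux `ConservativeEngine.ConservativePowerGaugeEulerLiouville`) and its DISSIPATIVE half X_Eᵈ (members with non-zero defect;
OFF the cone of the node's deciding theorem `Theorems.ConservativeEngine.navierStokesRegularity_of_conservativeEngine`).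
Lens `xe_iff` / `conservative_of_xe` (HOME/decomp-ns-lens-6/ConservativeEngine.lean §1/§6). [cite: DuchonRobert2000 §2]
-/

noncomputable section

set_option linter.dupNamespace false

open MeasureTheory TopologicalSpace Set Function Filter Topology Metric Module
open scoped NNReal ENNReal InnerProductSpace RealInnerProductSpace Laplacian

namespace Summit.NavierStokesRegularity.NavierStokesRegularity.Theorems.ConservativeEngine

open Literature.Analysis Literature.Analysis.FluidPDE Literature.Analysis.FunctionSpaces
open Summit.NavierStokesRegularity.NavierStokesRegularity.Theses.EulerZoomLiouville
open Summit.NavierStokesRegularity.NavierStokesRegularity.Theorems.SereginZoomReduction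


/-! ## §6  Certificates -/

/-- CERTIFICATE (exact cut): `X_E` (stmt-19832, verbatim decl) ⟺ X_Eᶜ (the child route's crux text) ∧ X_Eᵈ (its dissipative
half, off the cone of the deciding theorem) — excluded middle on the local energy equality of the member. -/
theorem powerGaugeEulerLiouville_iff_conservative_and_dissipative :
    PowerGaugeEulerLiouville ↔
      (∀ ρ : ℝ, 0 < ρ → ∀ (u : ℝ → (EuclideanSpace ℝ (Fin 3)) → (EuclideanSpace ℝ (Fin 3))) (p : ℝ → (EuclideanSpace ℝ (Fin 3)) → ℝ) (H : ℝ → (EuclideanSpace ℝ (Fin 3)) → (EuclideanSpace ℝ (Fin 3)) →L[ℝ] (EuclideanSpace ℝ (Fin 3))) (c : ℝ≥0),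
        IsSuitableWeakSolutionOn (slab (EuclideanSpace ℝ (Fin 3)) (Set.Iio 0) isOpen_Iio) 0 0 u p →
        HasWeakSpatialGradientOn (slab (EuclideanSpace ℝ (Fin 3)) (Set.Iio 0) isOpen_Iio) u H →
        (∀ a : ℝ, 0 < a →
          ENNReal.ofReal (a ^ (2 * ρ)) * cknA a (0 : ℝ × (EuclideanSpace ℝ (Fin 3))) u + ENNReal.ofReal (a ^ ρ) * cknE a (0 : ℝ × (EuclideanSpace ℝ (Fin 3))) H +
            ENNReal.ofReal (a ^ (2 * ρ)) * cknD a (0 : ℝ × (EuclideanSpace ℝ (Fin 3))) p ≤ (c : ℝ≥0∞)) →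
        (∀ φ : ℝ → (EuclideanSpace ℝ (Fin 3)) → ℝ, IsSpaceTimeTestOn (slab (EuclideanSpace ℝ (Fin 3)) (Set.Iio 0) isOpen_Iio) φ →
          ∫ t, ∫ x, (‖u t x‖ ^ 2 * timeDeriv φ t x + (‖u t x‖ ^ 2 + 2 * p t x) * ⟪u t x, gradient (φ t) x⟫) = 0) →
        Function.uncurry u =ᵐ[volume.restrict (Set.Iio (0 : ℝ) ×ˢ (Set.univ : Set (EuclideanSpace ℝ (Fin 3))))] 0) ∧
      (∀ ρ : ℝ, 0 < ρ → ∀ (u : ℝ → (EuclideanSpace ℝ (Fin 3)) → (EuclideanSpace ℝ (Fin 3))) (p : ℝ → (EuclideanSpace ℝ (Fin 3)) → ℝ) (H : ℝ → (EuclideanSpace ℝ (Fin 3)) → (EuclideanSpace ℝ (Fin 3)) →L[ℝ] (EuclideanSpace ℝ (Fin 3))) (c : ℝ≥0),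
        IsSuitableWeakSolutionOn (slab (EuclideanSpace ℝ (Fin 3)) (Set.Iio 0) isOpen_Iio) 0 0 u p →
        HasWeakSpatialGradientOn (slab (EuclideanSpace ℝ (Fin 3)) (Set.Iio 0) isOpen_Iio) u H →
        (∀ a : ℝ, 0 < a →
          ENNReal.ofReal (a ^ (2 * ρ)) * cknA a (0 : ℝ × (EuclideanSpace ℝ (Fin 3))) u + ENNReal.ofReal (a ^ ρ) * cknE a (0 : ℝ × (EuclideanSpace ℝ (Fin 3))) H +
            ENNReal.ofReal (a ^ (2 * ρ)) * cknD a (0 : ℝ × (EuclideanSpace ℝ (Fin 3))) p ≤ (c : ℝ≥0∞)) →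
        ¬ (∀ φ : ℝ → (EuclideanSpace ℝ (Fin 3)) → ℝ, IsSpaceTimeTestOn (slab (EuclideanSpace ℝ (Fin 3)) (Set.Iio 0) isOpen_Iio) φ →
          ∫ t, ∫ x, (‖u t x‖ ^ 2 * timeDeriv φ t x + (‖u t x‖ ^ 2 + 2 * p t x) * ⟪u t x, gradient (φ t) x⟫) = 0) →
        Function.uncurry u =ᵐ[volume.restrict (Set.Iio (0 : ℝ) ×ˢ (Set.univ : Set (EuclideanSpace ℝ (Fin 3))))] 0) := by
  constructor
  · intro h
    exact ⟨fun ρ hρ u p H c h1 h2 h3 _ => h ρ hρ u p H c h1 h2 h3,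
      fun ρ hρ u p H c h1 h2 h3 _ => h ρ hρ u p H c h1 h2 h3⟩
  · rintro ⟨hc, hd⟩ ρ hρ u p H c h1 h2 h3
    by_cases hcons : ∀ φ : ℝ → (EuclideanSpace ℝ (Fin 3)) → ℝ, IsSpaceTimeTestOn (slab (EuclideanSpace ℝ (Fin 3)) (Set.Iio 0) isOpen_Iio) φ →
        ∫ t, ∫ x, (‖u t x‖ ^ 2 * timeDeriv φ t x + (‖u t x‖ ^ 2 + 2 * p t x) * ⟪u t x, gradient (φ t) x⟫) = 0
    · exact hc ρ hρ u p H c h1 h2 h3 hcons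
    · exact hd ρ hρ u p H c h1 h2 h3 hcons

/-- CERTIFICATE (WEAKER, formally): `X_E ⟹ X_Eᶜ`. -/
theorem conservative_of_powerGaugeEulerLiouville (h : PowerGaugeEulerLiouville) :
    ∀ ρ : ℝ, 0 < ρ → ∀ (u : ℝ → (EuclideanSpace ℝ (Fin 3)) → (EuclideanSpace ℝ (Fin 3))) (p : ℝ → (EuclideanSpace ℝ (Fin 3)) → ℝ) (H : ℝ → (EuclideanSpace ℝ (Fin 3)) → (EuclideanSpace ℝ (Fin 3)) →L[ℝ] (EuclideanSpace ℝ (Fin 3))) (c : ℝ≥0),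
        IsSuitableWeakSolutionOn (slab (EuclideanSpace ℝ (Fin 3)) (Set.Iio 0) isOpen_Iio) 0 0 u p →
        HasWeakSpatialGradientOn (slab (EuclideanSpace ℝ (Fin 3)) (Set.Iio 0) isOpen_Iio) u H →
        (∀ a : ℝ, 0 < a →
          ENNReal.ofReal (a ^ (2 * ρ)) * cknA a (0 : ℝ × (EuclideanSpace ℝ (Fin 3))) u + ENNReal.ofReal (a ^ ρ) * cknE a (0 : ℝ × (EuclideanSpace ℝ (Fin 3))) H +
            ENNReal.ofReal (a ^ (2 * ρ)) * cknD a (0 : ℝ × (EuclideanSpace ℝ (Fin 3))) p ≤ (c : ℝ≥0∞)) →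
        (∀ φ : ℝ → (EuclideanSpace ℝ (Fin 3)) → ℝ, IsSpaceTimeTestOn (slab (EuclideanSpace ℝ (Fin 3)) (Set.Iio 0) isOpen_Iio) φ →
          ∫ t, ∫ x, (‖u t x‖ ^ 2 * timeDeriv φ t x + (‖u t x‖ ^ 2 + 2 * p t x) * ⟪u t x, gradient (φ t) x⟫) = 0) →
        Function.uncurry u =ᵐ[volume.restrict (Set.Iio (0 : ℝ) ×ˢ (Set.univ : Set (EuclideanSpace ℝ (Fin 3))))] 0 :=
  (powerGaugeEulerLiouville_iff_conservative_and_dissipative.1 h).1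

end Summit.NavierStokesRegularity.NavierStokesRegularity.Theorems.ConservativeEngine

end
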